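import Literature.Claims.NS.Strange2025
import Literature.Barriers.NavierStokesRegularity.KovalevskayaHeatRadiusZero
import HarnessLib

/-!
# C48 `Strange2025` — companion refutation of the F15 twin of Theorem 3.2 (`Step3_inference_heat`,
# proof of Theorem 3.2 p. 8: «the right hand side of (1.1) is analytic and u(t,x) ∈ C^ω(X)»)

Cell `ns-claims` (D-0090 NS-CLAIMS SWEEP), claim C48; typed skeleton `Literature.Claims.NS.Strange2025`
(p481623, typist-9 g2). The row is ADJUDICATED #58 on `not_Step2_ClayDataAnalytic` (record file
`SoloRefuteStrange2025.lean`, p483461, untouched by this module; locator Step 2 = Corollary 4.1 proof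
(4.3) p. 12). This SEPARATE companion module decides the charitable locus recorded there («unfilled gap
at the NS grain / Kovalevskaya at the twin»): the scalar twin `Step3_inference_heat` of the printed
inference «analytic datum ⇒ jointly real-analytic local solution» is false. KIT by ns-claims-typist-9 g2
(`SoloRefuteStrange2025.rev2-typist9-kit.lean`, sha16 827a771afd443ecc — a full Kovalevskaya computation),
ADOPTED by the refuter of record ns-claims-refuter-6 and SHORTENED to an instance of the tree's barrier
theorem `Literature.Barriers.NavierStokesRegularity.Kovalevskaya.not_exists_jointlyAnalytic_heat_solution`
(`Literature/Barriers/NavierStokesRegularity/KovalevskayaHeatRadiusZero.lean`, the same argument, already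
landed — the gate's `dedup.landed` pointed to it); filed by the salvage lane (conv. (b)).
Text of record: J. Strange, arXiv:2501.08353 v3 [Strange2025], Theorem 3.2 and its proof p. 8; §1 p. 1
(the Cauchy–Kovalevskaya sentence).

WHAT IS PROVED: `not_Step3_inference_heat : ¬ Literature.Claims.NS.Strange2025.Step3_inference_heat` —
Kovalevskaya's heat-equation example (Cooke's variant): for the datum `h₀(x) = 1/(1+x²)`, real-analytic on
`ℝ`, and `ν = 1` there is no `h` with `(t,x) ↦ h t x` jointly real-analytic on the open strip
`{t > −ε} × ℝ ∋ (0,0)`, solving `∂ₜh = ∂ₓ²h` there and equal to `h₀` at `t = 0` (the PDE forces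
`∂ₜᵐh(0,0) = (−1)ᵐ(2m)!`, against the Cauchy bound `m!·C/rᵐ` of a function analytic in `t`).
(S. Kowalevsky, J. reine angew. Math. 80 (1875) 1–32; R. Cooke, *The Mathematics of Sonya Kovalevskaya*,
Springer 1984, Ch. 2.)

Closed term; axioms `propext`, `Classical.choice`, `Quot.sound`.

WHAT THIS IS NOT: not a claim about NS regularity or blow-up; not a claim about any author beyond the
typed locator.
-/

-- The summit's canonical theorem namespace repeats the summit name (single-conjunct summit).
set_option linter.dupNamespace false

noncomputable section

open Set Function Filter Topology

namespace Summit.NavierStokesRegularity.NavierStokesRegularity.Theorems.Strange2025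

open Literature.Claims.NS.Strange2025 Literature.Barriers.NavierStokesRegularity.Kovalevskaya

/-- **`¬ Step3_inference_heat`** (Kovalevskaya's example, via the tree's barrier theorem).
[cite: Strange2025, Theorem 3.2 proof p. 8] -/
theorem not_Step3_inference_heat : ¬ Literature.Claims.NS.Strange2025.Step3_inference_heat := by
  intro h
  obtain ⟨ε, hε, hh, han, hpde, hinit⟩ := h 1 one_pos kovalevskayaDatum kovalevskayaDatum_analytic
  have hU : IsOpen (Ioi (-ε) ×ˢ (univ : Set ℝ)) := isOpen_Ioi.prod isOpen_univ
  have h00 : ((0 : ℝ), (0 : ℝ)) ∈ Ioi (-ε) ×ˢ (univ : Set ℝ) := ⟨neg_lt_zero.mpr hε, mem_univ _⟩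
  refine not_exists_jointlyAnalytic_heat_solution one_pos hU h00 ⟨hh, han, ?_, ?_⟩
  · rintro ⟨t, x⟩ ⟨ht, -⟩
    exact hpde t ht x
  · exact Eventually.of_forall fun x => by rw [hinit]

end Summit.NavierStokesRegularity.NavierStokesRegularity.Theorems.Strange2025

end
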